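import Summits.ResolutionOfSingularities.ResolutionOfSingularities.Theorems.WildConesClassicalRegimesDefs
import Summits.ResolutionOfSingularities.ResolutionOfSingularities.Theorems.WildConesClassicalRegimesStubMuDropCurve
import Summits.ResolutionOfSingularities.ResolutionOfSingularities.Theorems.WildConesClassicalRegimesStubOrdPExitSurface
import Summits.ResolutionOfSingularities.ResolutionOfSingularities.Theorems.WildConesClassicalRegimesStubHighOrdNotIsol
import Summits.ResolutionOfSingularities.ResolutionOfSingularities.Theorems.WildConesClassicalRegimesStubCaseAExitOrdSucc
import Summits.ResolutionOfSingularities.ResolutionOfSingularities.Theorems.WildConesClassicalRegimesStubMuDropSurfaceOrdSucc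
import Summits.ResolutionOfSingularities.ResolutionOfSingularities.Theorems.WildConesClassicalRegimesStubMuDropCharTwoOrdPDict
import Summits.ResolutionOfSingularities.ResolutionOfSingularities.Theorems.WildConesClassicalRegimesStubMuDropCharTwoOrdPInduction

/-!
# Crux `ClassicalRegimes` (stmt-ResolutionOfSingularities-16884, route `WildCones`) — PROVED
# (line `milnor-descent`: the Milnor number is a strict Lyapunov function of the point-blow-up dynamics)

`ClassicalRegimes` is the route's TARGET `IsolatedForcedTermination` — no infinite run of the
point-blow-up dynamics of a height-one atom `z^p = a(u₁, …, uₙ)` over a perfect field of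
characteristic `p` has every state ISOLATED of multiplicity `p` — restricted to the classical regimes
`n ≤ 2 ∨ p = 2`. The dynamics, the predicates `Isol`/`MultP`/`OrdP`/`OrdPSucc`, the colength `mu`,
`InfRun` and the bridge `classicalRegimes_iff` (`Iff.rfl`) are `Theorems/WildConesClassicalRegimesDefs.lean`.

This file is the registered skeleton `Cruxes/ClassicalRegimes/Lines/milnor_descent.lean` (v5, sha
4126482c…) with its LAST stub discharged:

* `stub_muDropCharTwoOrdP` (p = 2, n ≥ 3: one-step Milnor drop at an isolated double state with an
  isolated double successor) := `MuDropCharTwoOrdP.muDrop_of_seriesDrop (MuDropCharTwoOrdP.series_drop n)`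
  — the char-two DICTIONARY (`…StubMuDropCharTwoOrdPDict.lean`: the blow-up identity is the sibling
  crux's `NarrowRunsDie.stub_dict`, the hand-rolled `pd` is `MvPowerSeries.pderiv`, cleaning is
  invisible to derivatives in characteristic two) applied to the FORMAL DROP
  (`…StubMuDropCharTwoOrdPInduction.lean`: hyperbolic-pair descent over the eight helper files
  Generic/BlowFam/Reduction/Descent/Leaves/Jets/Noether/Surface — Greuel–Pfister splitting, Case A,
  the curve leaf, Max Noether for the surface leaf);
* the five other stubs were landed on 2026-08-17: `stub_muDropCurve` (n = 1), `stub_ordPExitSurface`,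
  `stub_highOrdNotIsol`, `stub_muDropSurfaceOrdSucc` (n = 2), `stub_caseAExitOrdSucc` (n ≥ 3);
* the composition `ClassicalRegimes_of_muDrop`: along an infinite isolated multiplicity-`p` run, `μ`
  drops at every step, regime by regime, and a strictly decreasing `ℕ`-sequence is absurd.

Everything here is OURS (campaign res-hironaka, rung L, slot W4.1, chain w41); it replaces the role
of no printed item and is NOT a statement of Hironaka's manuscript.
-/

noncomputable section

-- single-problem summit: the doubled namespace component `ResolutionOfSingularities` is forced
set_option linter.dupNamespace false

open scoped BigOperators Classical

open Summit.ResolutionOfSingularities.ResolutionOfSingularities.Theses.WildCones (ClassicalRegimes)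

namespace Summit.ResolutionOfSingularities.ResolutionOfSingularities.Theorems.WildCones

/-! ## The last stub of line `milnor-descent` -/

/-- **STUB `stub_muDropCharTwoOrdP` of line `milnor-descent`, PROVED** (registered name and
signature): characteristic two, `n ≥ 3` — if a state `c` and its successor `step i τ c` are both
isolated of multiplicity two, the Milnor number drops, `μ(step i τ c) < μ(c)` (the two "cleaned order
exactly two" hypotheses of the registered signature are not needed). The char-two dictionary
`MuDropCharTwoOrdP.muDrop_of_seriesDrop` applied to the formal drop `MuDropCharTwoOrdP.series_drop`.
[cite: GreuelPfister2026, Thm 3.5 and Cor 3.7] -/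
theorem stub_muDropCharTwoOrdP :
    ∀ n : ℕ, 3 ≤ n → ∀ (κ : Type) [Field κ] [CharP κ 2] [PerfectField κ]
    (c : (Fin n → ℕ) → κ) (i : Fin n) (τ : Fin n → κ),
    Isol 2 n κ c → MultP 2 n κ c → OrdP 2 n κ c → Isol 2 n κ (step 2 n κ i τ c) →
      MultP 2 n κ (step 2 n κ i τ c) → OrdP 2 n κ (step 2 n κ i τ c) →
        mu 2 n κ (step 2 n κ i τ c) < mu 2 n κ c :=
  fun n _ _ _ _ _ c i τ hI hM _ hI' hM' _ =>
    MuDropCharTwoOrdP.muDrop_of_seriesDrop (MuDropCharTwoOrdP.series_drop n) c i τ hI hM hI' hM'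

/-! ## The composition (the registered skeleton's, verbatim up to the discharged stub) -/

/-- A strictly decreasing sequence of natural numbers is absurd. [folklore] -/
theorem no_strictAnti_nat (f : ℕ → ℕ) (h : ∀ m, f (m + 1) < f m) : False := by
  have key : ∀ m, f m + m ≤ f 0 := by
    intro m
    induction m with
    | zero => simp
    | succ m ih => have := h m; omega
  have := key (f 0 + 1)
  omega

/-- **Surfaces (`n = 2`, every `p`): `μ` drops at every step of an infinite isolated multiplicity-`p`
run** — the order-`p` exit and the high-order exit force every state to have cleaned order exactly
`p + 1`, and then the order-`(p+1)` drop applies. [folklore] -/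
theorem mu_lt_of_infRun_two {p : ℕ} (hp : p.Prime) {κ : Type}
    [Field κ] [CharP κ p] [PerfectField κ] {c₀ : (Fin 2 → ℕ) → κ} {i : ℕ → Fin 2} {t : ℕ → Fin 2 → κ}
    (hall : InfRun p 2 κ c₀ i t) (m : ℕ) :
    mu p 2 κ (run p 2 κ c₀ i t (m + 1)) < mu p 2 κ (run p 2 κ c₀ i t m) := by
  -- every state of the run has cleaned order exactly `p + 1`
  have hO : ∀ k, ¬ OrdP p 2 κ (run p 2 κ c₀ i t k) := fun k hO =>
    stub_ordPExitSurface p hp κ _ (i k) (t k) (hall k).2 hO (hall (k + 1)).2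
  have hS : ∀ k, OrdPSucc p 2 κ (run p 2 κ c₀ i t k) := fun k => by
    by_contra hS
    exact stub_highOrdNotIsol p hp 2 le_rfl κ _ (i k) (t k) (hall k).2 (hO k) hS (hall (k + 1)).1
  exact stub_muDropSurfaceOrdSucc p hp κ _ (i m) (t m) (hall m).1 (hall m).2 (hO m) (hS m) (hall (m + 1)).1
    (hall (m + 1)).2 (hO (m + 1))

/-- **Characteristic two, `n ≥ 3`: `μ` drops at every step of an infinite isolated double run** —
a state of cleaned order `≥ 3` has no isolated double successor (Case A / high-order exit), so every
state has cleaned order exactly `2` and the char-two drop `stub_muDropCharTwoOrdP` applies.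
[folklore] -/
theorem mu_lt_of_infRun_charTwo
    {n : ℕ} (hn : 3 ≤ n) {κ : Type} [Field κ] [CharP κ 2] [PerfectField κ] {c₀ : (Fin n → ℕ) → κ}
    {i : ℕ → Fin n} {t : ℕ → Fin n → κ} (hall : InfRun 2 n κ c₀ i t) (m : ℕ) :
    mu 2 n κ (run 2 n κ c₀ i t (m + 1)) < mu 2 n κ (run 2 n κ c₀ i t m) := by
  -- every state of the run has cleaned order exactly `2`
  have hO : ∀ k, OrdP 2 n κ (run 2 n κ c₀ i t k) := fun k => by
    by_contra hO
    by_cases hS : OrdPSucc 2 n κ (run 2 n κ c₀ i t k)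
    · exact stub_caseAExitOrdSucc 2 Nat.prime_two n hn κ _ (i k) (t k) (hall k).2 hO hS (hall (k + 1)).1
        (hall (k + 1)).2
    · exact stub_highOrdNotIsol 2 Nat.prime_two n (by omega) κ _ (i k) (t k) (hall k).2 hO hS
        (hall (k + 1)).1
  exact stub_muDropCharTwoOrdP n hn κ _ (i m) (t m) (hall m).1 (hall m).2 (hO m) (hall (m + 1)).1
    (hall (m + 1)).2 (hO (m + 1))

/-- **`ClassicalRegimes`, assembled**: re-point the crux (`classicalRegimes_iff`), show that `μ` drops
at every step of an infinite isolated multiplicity-`p` run regime by regime (`n = 1`: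
`stub_muDropCurve`; `n = 2`: `mu_lt_of_infRun_two`; `p = 2 ∧ n ≥ 3`: `mu_lt_of_infRun_charTwo`), and
conclude by `no_strictAnti_nat`. [folklore] -/
theorem ClassicalRegimes_of_muDrop : ClassicalRegimes := by
  rw [classicalRegimes_iff]
  intro p hp n hn hreg κ _ _ _ c₀ i t hall
  refine no_strictAnti_nat (fun m => mu p n κ (run p n κ c₀ i t m)) fun m => ?_
  by_cases hle : n ≤ 2
  · interval_cases n
    · exact stub_muDropCurve p hp κ _ (i m) (t m) (hall m).1 (hall m).2 (hall (m + 1)).1 (hall (m + 1)).2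
    · exact mu_lt_of_infRun_two hp hall m
  · rcases hreg with hle' | rfl
    · exact absurd hle' hle
    · exact mu_lt_of_infRun_charTwo (by omega) hall m

/-- **THE CRUX `ClassicalRegimes` (stmt-ResolutionOfSingularities-16884), PROVED** — in the classical
regimes `n ≤ 2 ∨ p = 2` no run of the point-blow-up dynamics of a height-one atom over a perfect field
has every state isolated of multiplicity `p`: the Milnor number `μ = dim_κ κ⟦u⟧/(∂a)` is a strict
Lyapunov function. OURS (route WildCones); NOT a statement of Hironaka's manuscript.
[cite: GreuelPfister2026, Thm 3.5 and Cor 3.7] -/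
theorem ClassicalRegimes_proof : ClassicalRegimes :=
  ClassicalRegimes_of_muDrop

end Summit.ResolutionOfSingularities.ResolutionOfSingularities.Theorems.WildCones

end
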